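import Summits.QuantumFields.YangMills.Theorems.BalabanUVNodesN20ByValueLadder
import Literature.MathematicalPhysics.QuantumFieldTheory.Balaban1983to89.TorusReflectionPositivity
import Literature.MathematicalPhysics.QuantumLattice.LatticeGaugeDLR
import HarnessLib

/-!
# Crux `UVSeamRec` (stmt-QuantumFields-20043), slot `stub_ceilings` (E0′): the POLYMER DATA of the tempered architecture, I —
# N20's block-averaged large-field currency `ε ≤ 1 − reTr Ū^k(∂p)` read on `ℤ⁴` configurations through a centred chart and
# the dictionary `ofConfig`; polymers, influence coefficients `(b^k / dist)⁴`, the exterior shell of a cube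

Definition file (`--kind definition --supports stmt-QuantumFields-20043 --as helper`) of the unit `ym-20043-tempered-d1` (D1 of the
route owner's rulings R86d/R86e, ym-beyond INBOX 2026-08-27T11:29Z/11:40Z; LEAD ym-spine-20043-p1 g7 (C) 11:28Z); sibling file
`…PolymerInfluence.lean` (the linear influence functional, the tempered class `{I < θ}`, the shapes p528131 consumes).  HONEST
FRAMING: definitions and measurability only — the objects in which the two OPEN renormalisation-group hypotheses of the v5 shape of
`stub_ceilings` are stated, (a) a TEMPERED centre law for exteriors of small influence and (PL) a Peierls product law for the
large-field polymer gas of the Wilson state on odd tori (consumed by ceilings-p2's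
`PolymerRarity.momentBounds6_of_temperedLaw_and_polymerLaw`, p528131).  No law, no rarity, nothing of E0′ is asserted here; the
bookkeeping inequalities `Σ_i c_{iγ} ≤ Λ`, `Σ_γ c_{iγ} w_γ ≤ W` of (PL) stay hypotheses of that stub (owner R86e (2)).  Not a gap,
not Clay.

THE TWO VOCABULARIES AND THE CHART.  N20's currency (`Theorems/BalabanUVNodesN20ByValueMultiscaleWall.lean`) is the k-fold (0.4)
block average `Ū^k = Averaging.iter (fun _ => BlockAveraging.blockAvg ExpMeanLog.expMeanLogSU) k U` of a configuration `U` of a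
BAŁABAN torus `GaugeField P 0 SU(N)` and its plaquette fields `1 − reTr Ū^k(∂p)`, `p : Plaq P k`; the Y2 currency of `MomentBounds6`
(`DlrCollarTransfer.torusE`, `kerE`, `plane`) lives on `ℤ⁴` configurations `LGConfig 4 G` read periodically on ODD tori through
`torusLift (2L+1)`.  Bałaban's tori are EVEN (`Params.sitesPerDir j = 2·b^{m+K−j}`; osasm-p1's dictionary
`Theorems/BalabanLadderUVTorusDictionary.lean`, `family_sitesPerDir_ne_odd`), so no odd torus IS a Bałaban lattice; the pull-back used
here is LOCAL instead: for a polymer `γ = (k, y, μ<ν)` — level `k`, block index `y ∈ ℤ⁴`, orientation — the `ℤ⁴` configuration `η` is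
read on the chart torus `T^{(0)}` of `chartParams 𝔟 k` (`d = 4`, block size `b`, `m = 1`, `K = k`: `2b^{k+1}` fine sites per direction)
translated so that the `k`-block of `y`, i.e. the fine sites `b^k y + [0, b^k)^4`, is the block of the CENTRAL `k`-site `(b−1,…,b−1)` of
`T^{(k)}` (`chart (chartOrigin 𝔟 k y) η`, then `ofConfig`), and `blockField 𝔟 k y μ ν η := 1 − reTr Ū^k(∂p)` at the central
`k`-plaquette `p = ((b−1)·𝟙; μ, ν)`.  The chart covers `b^k y + [−(b−1)b^k, (b+1)b^k)^4 ⊂ ℤ⁴`, a margin of `(b−1)·b^k ≥ 2b^k` fine sites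
around the two-block span of `∂p`, so by the locality of the block averaging (`BlockAveraging.avgFun_local`, standing range
`j+1 ≤ m+K = k+1`) no averaging word wraps around the chart torus: `blockField` is the honest `k`-level block-averaged plaquette field of
`η` at the `k`-plaquette of `b^k ℤ⁴` based at `b^k y` (corner convention for blocks of `ℤ⁴`; Bałaban's centred convention is the
chart's).  This locality is recorded in prose only — nothing below uses it; every theorem below is measurability or order bookkeeping.

CONTENTS.  §1 chart (`BlockSize`, `chartParams`, `chartOrigin`, `chart`, `centralPlaq`, measurability); §2 `blockField` and its
measurability and range `[0,2]`; §3 polymers, anchors, sup-distance, `influenceCoeff 𝔟 γ x = (b^k / dist_∞(x, b^k y))⁴` (owner R86e (2),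
LEAD (C): the influence of a scale-`b^k` large field at distance `d` on the curvature at `x` — dimension 4 of `tr F²`), the exterior
SHELL of polymers of the radius-`(R+1)` cube around `x` up to level `kmax` (`shell`, `mem_shell_iff`), `c ≤ 1/16` on the shell;
§4 `largeFieldEvent 𝔟 ε γ = {η | ε ≤ blockField … η}` (N20's large-field event, a [Balaban1989LargeFieldI] (0.3)–(0.5)-kind small-field
condition negated) and its measurability.

References (locators): T. Bałaban, Commun. Math. Phys. 109 (1987) 249–301, (0.4) p. 253 (block averaging); 122 (1989) 175–202,
(0.3)–(0.5) pp. 176–177 and 355–392, (1.79) p. 383 (small/large fields of the averaged configurations); the tree modules cited above.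
-/

set_option autoImplicit false

noncomputable section

open MeasureTheory
open Literature.MathematicalPhysics.QuantumFieldTheory (GaugeConfig)
open Literature.MathematicalPhysics.QuantumFieldTheory.Balaban1983to89
open Literature.MathematicalPhysics.QuantumLattice (LGConfig torusLift)
open Summit.QuantumFields.YangMills.BalabanUVNodes.N20ByValueLadder (measurable_iterBlockAvg)

namespace Summit.QuantumFields.YangMills.Cruxes.UVSeamRec.PolymerData

/-! ## §1 The chart: a `ℤ⁴` configuration read on a Bałaban torus whose central `k`-block is a given block of `b^k ℤ⁴` -/

/-- A block size of Bałaban's kind: an odd integer `b > 1` (the `L` of [Balaban1987RG1] (0.1); called `b` here because `L` is the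
odd-torus half-side in the Y2 currency). -/
structure BlockSize where
  /-- the block size -/
  b : ℕ
  /-- odd and `> 1`, as `Params.hL` demands -/
  hb : Odd b ∧ 1 < b

namespace BlockSize

/-- The smallest admissible block size `b = 3` (a default inhabitant; any odd `b > 1` is admissible). -/
def three : BlockSize := ⟨3, by decide, by norm_num⟩

/-- `1 ≤ b`. -/
theorem one_le (𝔟 : BlockSize) : 1 ≤ 𝔟.b := 𝔟.hb.2.le

/-- `0 < b`. -/
theorem pos (𝔟 : BlockSize) : 0 < 𝔟.b := 𝔟.one_le

/-- `1 ≤ b^k` in `ℤ`. -/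
theorem one_le_pow (𝔟 : BlockSize) (k : ℕ) : (1 : ℤ) ≤ (𝔟.b : ℤ) ^ k :=
  one_le_pow₀ (by exact_mod_cast 𝔟.one_le)

end BlockSize

/-- The chart torus parameters for level `k`: dimension `4`, block size `b`, volume exponent `m = 1`, `K = k` RG levels — so the
finest torus `T^{(0)}` has `2b^{k+1}` sites per direction and `T^{(k)}` has `2b` (an `abbrev`, so that `(chartParams 𝔟 k).d` reduces
to `4`). -/
abbrev chartParams (𝔟 : BlockSize) (k : ℕ) : Params :=
  { d := 4, L := 𝔟.b, m := 1, K := k, hd := by decide, hL := 𝔟.hb }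

/-- Site counts of the chart tori: `2·b^{1+k−j}` per direction at level `j`. -/
theorem chartParams_sitesPerDir (𝔟 : BlockSize) (k j : ℕ) : (chartParams 𝔟 k).sitesPerDir j = 2 * 𝔟.b ^ (1 + k - j) := rfl

/-- The chart origin for the block index `y ∈ ℤ⁴` at level `k`: `o = b^k · (y − (b−1)·𝟙)`, so that the fine chart coordinate
`t ∈ [0, 2b^{k+1})` is the `ℤ⁴` coordinate `o + t` and the central `k`-block `[(b−1)b^k, b·b^k)` of the chart is `b^k y + [0, b^k)`. -/
def chartOrigin (𝔟 : BlockSize) (k : ℕ) (y : Fin 4 → ℤ) : Fin 4 → ℤ :=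
  fun i => (𝔟.b : ℤ) ^ k * (y i - ((𝔟.b : ℤ) - 1))

/-- THE CHART: a `ℤ⁴` configuration `η` read as a configuration of the wave-0 torus `(ℤ/M)⁴` translated by `o`:
`(chart o η)(t, μ) = η(o + val t, μ)` (`val t ∈ [0, M)^4` the canonical representatives). -/
def chart {G : Type*} {M : ℕ} (o : Fin 4 → ℤ) (η : LGConfig 4 G) : GaugeConfig 4 M G :=
  fun e => η (fun i => o i + ((e.1 i).val : ℤ), e.2)

/-- `chart` evaluated. -/
@[simp] theorem chart_apply {G : Type*} {M : ℕ} (o : Fin 4 → ℤ) (η : LGConfig 4 G)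
    (e : Literature.MathematicalPhysics.QuantumFieldTheory.Edge 4 M) :
    chart (M := M) o η e = η (fun i => o i + ((e.1 i).val : ℤ), e.2) := rfl

/-- The chart is measurable (a re-indexing of coordinates). -/
theorem measurable_chart {G : Type*} [MeasurableSpace G] {M : ℕ} (o : Fin 4 → ℤ) :
    Measurable (chart (M := M) o : LGConfig 4 G → GaugeConfig 4 M G) :=
  measurable_pi_lambda _ fun _ => measurable_pi_apply _

/-- The central `k`-plaquette of the chart: base point `(b−1, b−1, b−1, b−1) ∈ T^{(k)}` (`2b` sites per direction), orientation
`μ < ν`; its two-block span `[(b−1)b^k, (b+1)b^k)` keeps a margin `(b−1)b^k` to the chart boundary on both sides. -/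
def centralPlaq (𝔟 : BlockSize) (k : ℕ) (μ ν : Fin 4) (h : μ < ν) : Plaq (chartParams 𝔟 k) k :=
  ⟨fun _ => ((𝔟.b - 1 : ℕ) : ZMod ((chartParams 𝔟 k).sitesPerDir k)), μ, ν, h⟩

/-! ## §2 The `k`-level block-averaged plaquette field of a `ℤ⁴` configuration and N20's large-field event -/

section Field

variable {N : ℕ} [NeZero N]

/-- Bałaban's `k`-fold (0.4) block average of record on the chart torus, `Ū^k = M^k(U)` (`Averaging.iter` of
`BlockAveraging.blockAvg ExpMeanLog.expMeanLogSU`, exactly N20's averaging). (locator: [Balaban1987RG1] (0.4) p. 253). -/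
def blockAvgIter (𝔟 : BlockSize) (k : ℕ) :
    GaugeField (chartParams 𝔟 k) 0 (Matrix.specialUnitaryGroup (Fin N) ℂ) →
      GaugeField (chartParams 𝔟 k) k (Matrix.specialUnitaryGroup (Fin N) ℂ) :=
  Averaging.iter (P := chartParams 𝔟 k)
    (fun _ => BlockAveraging.blockAvg (ExpMeanLog.expMeanLogSU (n := Fin N))) k

/-- `Ū^k` is measurable (N20ByValueLadder's `measurable_iterBlockAvg` on the chart torus). -/
theorem measurable_blockAvgIter (𝔟 : BlockSize) (k : ℕ) : Measurable (blockAvgIter (N := N) 𝔟 k) :=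
  measurable_iterBlockAvg (chartParams 𝔟 k) k

/-- **THE `k`-LEVEL BLOCK-AVERAGED PLAQUETTE FIELD OF A `ℤ⁴` CONFIGURATION** (N20's currency pulled back along the chart and the
dictionary `ofConfig`): `blockField 𝔟 k y μ ν η = 1 − reTr Ū^k(∂p)`, `Ū^k` the `k`-fold block average of `η` read on the chart torus
centred at the block `b^k y + [0,b^k)^4`, `p` the central `k`-plaquette of orientation `μ < ν`; values in `[0, 2]`. -/
def blockField (𝔟 : BlockSize) (k : ℕ) (y : Fin 4 → ℤ) (μ ν : Fin 4) (h : μ < ν)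
    (η : LGConfig 4 (Matrix.specialUnitaryGroup (Fin N) ℂ)) : ℝ :=
  1 - reTr (GaugeField.plaqHol
    (blockAvgIter (N := N) 𝔟 k (ofConfig (P := chartParams 𝔟 k) (j := 0) (chart (chartOrigin 𝔟 k y) η)))
    (centralPlaq 𝔟 k μ ν h))

/-- The block-averaged plaquette field is measurable in the `ℤ⁴` configuration. -/
theorem measurable_blockField (𝔟 : BlockSize) (k : ℕ) (y : Fin 4 → ℤ) (μ ν : Fin 4) (h : μ < ν) :
    Measurable (blockField (N := N) 𝔟 k y μ ν h) := by
  unfold blockField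
  refine measurable_const.sub (RegularGaugeGroup.measurable_reTr.comp ?_)
  exact (Missing.measurable_plaqHol _).comp
    ((measurable_blockAvgIter (N := N) 𝔟 k).comp (measurable_ofConfig.comp (measurable_chart _)))

/-- `0 ≤ 1 − reTr Ū^k(∂p) ≤ 2`. -/
theorem blockField_mem_Icc (𝔟 : BlockSize) (k : ℕ) (y : Fin 4 → ℤ) (μ ν : Fin 4) (h : μ < ν)
    (η : LGConfig 4 (Matrix.specialUnitaryGroup (Fin N) ℂ)) :
    blockField (N := N) 𝔟 k y μ ν h η ∈ Set.Icc (0 : ℝ) 2 :=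
  RegularGaugeGroup.one_sub_reTr_mem_Icc _

end Field

/-! ## §3 Polymers, anchors, influence coefficients, the exterior shell of a cube -/

/-- A POLYMER of the large-field gas in N20's currency: a level `k`, a block index `y ∈ ℤ⁴` (the `k`-block `b^k y + [0,b^k)^4` of
`b^k ℤ⁴`, corner convention) and an orientation `μ < ν` — i.e. a `k`-plaquette of the block lattice `b^k ℤ⁴`. -/
structure Polymer where
  /-- the level (scale `b^k`) -/
  k : ℕ
  /-- the block index: the `k`-block is `b^k y + [0, b^k)^4` -/
  y : Fin 4 → ℤ
  /-- first direction of the plaquette -/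
  μ : Fin 4
  /-- second direction of the plaquette -/
  ν : Fin 4
  /-- positive orientation -/
  hμν : μ < ν
deriving DecidableEq

/-- The anchor `b^k y ∈ ℤ⁴` of a polymer (the corner of its `k`-block). -/
def anchor (𝔟 : BlockSize) (γ : Polymer) : Fin 4 → ℤ := fun i => (𝔟.b : ℤ) ^ γ.k * γ.y i

/-- The sup-norm distance of two sites of `ℤ⁴` (in lattice units). -/
def supDist (x z : Fin 4 → ℤ) : ℕ := Finset.univ.sup fun i => (x i - z i).natAbs

/-- Each coordinate difference is bounded by the sup-distance. -/
theorem natAbs_sub_le_supDist (x z : Fin 4 → ℤ) (i : Fin 4) : (x i - z i).natAbs ≤ supDist x z :=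
  Finset.le_sup (f := fun i => (x i - z i).natAbs) (Finset.mem_univ i)

/-- **THE INFLUENCE COEFFICIENT** of the polymer `γ` (scale `b^k`, anchor `b^k y`) on the curvature at the site `x`:
`c_γ(x) = (b^k / dist_∞(x, b^k y))⁴` (owner R86e (2), LEAD (C): a large field of size `b^k` at distance `d` shifts `⟨tr F²(x)⟩` by
`O((b^k/d)⁴)` — the scaling dimension `4` of `tr F²`; with Lean's `x/0 = 0` the coefficient vanishes at distance `0`). -/
def influenceCoeff (𝔟 : BlockSize) (γ : Polymer) (x : Fin 4 → ℤ) : ℝ :=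
  (((𝔟.b : ℝ) ^ γ.k) / (supDist x (anchor 𝔟 γ) : ℝ)) ^ 4

/-- Influence coefficients are nonnegative. -/
theorem influenceCoeff_nonneg (𝔟 : BlockSize) (γ : Polymer) (x : Fin 4 → ℤ) : 0 ≤ influenceCoeff 𝔟 γ x := by
  unfold influenceCoeff
  positivity

/- SHELL CONDITION (written inline in `shell`, spelled out by `mem_shell_iff`): a polymer `γ` lies in the EXTERIOR SHELL of the
radius-`(R+1)` cube around `x` up to level `kmax` iff `k ≤ kmax` and `R + 2 + 2b^k ≤ dist_∞(x, b^k y) ≤ 2R + 2`.  The lower bound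
puts the whole two-block span `b^k y + [0, 2b^k]^4` of the plaquette (the fine region its block average reads) outside the cube
`{z | dist_∞(x, z) ≤ R+1}` (the DLR volume of `kerE … (x − (R+1)) (2R+3)`); the upper bound makes the shell finite (thickness `≍ R`:
the polymers whose influence on `x` is not dominated by nearer cubes' shells). -/

/-- The finite box of block indices scanned for the shell: `|y_i| ≤ |x_i| + 2R + 2` (generous; `mem_shellBox_of_supDist_le`). -/
def shellBox (R : ℕ) (x : Fin 4 → ℤ) : Finset (Fin 4 → ℤ) :=
  Fintype.piFinset fun i => Finset.Icc (-(|x i| + (2 * R + 2 : ℕ))) (|x i| + (2 * R + 2 : ℕ))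

/-- Every block index within sup-distance `2R+2` of `x` (after scaling by `b^k ≥ 1`) lies in the box. -/
theorem mem_shellBox_of_supDist_le (𝔟 : BlockSize) {R : ℕ} {x : Fin 4 → ℤ} {γ : Polymer}
    (h : supDist x (anchor 𝔟 γ) ≤ 2 * R + 2) : γ.y ∈ shellBox R x := by
  rw [shellBox, Fintype.mem_piFinset]
  intro i
  rw [Finset.mem_Icc]
  have hi : ((x i - anchor 𝔟 γ i).natAbs : ℤ) ≤ (2 * R + 2 : ℕ) := by
    exact_mod_cast (natAbs_sub_le_supDist x (anchor 𝔟 γ) i).trans h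
  have habs : |x i - (𝔟.b : ℤ) ^ γ.k * γ.y i| ≤ (2 * R + 2 : ℕ) := by
    rw [← Int.natCast_natAbs]; exact hi
  have hpow : (1 : ℤ) ≤ (𝔟.b : ℤ) ^ γ.k := 𝔟.one_le_pow γ.k
  have hy : |γ.y i| ≤ |(𝔟.b : ℤ) ^ γ.k * γ.y i| := by
    rw [abs_mul]
    exact le_mul_of_one_le_left (abs_nonneg _) ((le_abs_self _).trans' hpow)
  have htri : |(𝔟.b : ℤ) ^ γ.k * γ.y i| ≤ |x i| + (2 * R + 2 : ℕ) := by
    have := abs_sub_abs_le_abs_sub ((𝔟.b : ℤ) ^ γ.k * γ.y i) (x i)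
    rw [abs_sub_comm] at this
    linarith
  constructor
  · linarith [neg_abs_le (γ.y i), hy.trans htri]
  · linarith [le_abs_self (γ.y i), hy.trans htri]

/-- **THE EXTERIOR SHELL** of polymers of the radius-`(R+1)` cube around `x`, levels `≤ kmax`, as a `Finset`:
`{γ | k ≤ kmax, R + 2 + 2b^k ≤ dist_∞(x, b^k y) ≤ 2R + 2}` (see the SHELL CONDITION above). -/
def shell (𝔟 : BlockSize) (kmax R : ℕ) (x : Fin 4 → ℤ) : Finset Polymer :=
  ((Finset.range (kmax + 1) ×ˢ shellBox R x ×ˢ (Finset.univ : Finset {q : Fin 4 × Fin 4 // q.1 < q.2})).image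
    fun t => ⟨t.1, t.2.1, t.2.2.1.1, t.2.2.1.2, t.2.2.2⟩).filter fun γ =>
      γ.k ≤ kmax ∧ R + 2 + 2 * 𝔟.b ^ γ.k ≤ supDist x (anchor 𝔟 γ) ∧ supDist x (anchor 𝔟 γ) ≤ 2 * R + 2

/-- Membership in the shell is exactly the shell condition. -/
theorem mem_shell_iff (𝔟 : BlockSize) (kmax R : ℕ) (x : Fin 4 → ℤ) (γ : Polymer) :
    γ ∈ shell 𝔟 kmax R x ↔
      γ.k ≤ kmax ∧ R + 2 + 2 * 𝔟.b ^ γ.k ≤ supDist x (anchor 𝔟 γ) ∧ supDist x (anchor 𝔟 γ) ≤ 2 * R + 2 := by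
  rw [shell, Finset.mem_filter]
  refine ⟨fun h => h.2, fun h => ⟨?_, h⟩⟩
  rw [Finset.mem_image]
  refine ⟨(γ.k, γ.y, ⟨(γ.μ, γ.ν), γ.hμν⟩), ?_, rfl⟩
  simp only [Finset.mem_product, Finset.mem_range, Finset.mem_univ, and_true]
  exact ⟨Nat.lt_succ_of_le h.1, mem_shellBox_of_supDist_le 𝔟 h.2.2⟩

/-- Polymers of the shell have level `≤ kmax`. -/
theorem level_le_of_mem_shell {𝔟 : BlockSize} {kmax R : ℕ} {x : Fin 4 → ℤ} {γ : Polymer}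
    (h : γ ∈ shell 𝔟 kmax R x) : γ.k ≤ kmax :=
  ((mem_shell_iff 𝔟 kmax R x γ).1 h).1

/-- Polymers of the shell keep sup-distance `≥ R + 2 + 2b^k` from the centre. -/
theorem le_supDist_of_mem_shell {𝔟 : BlockSize} {kmax R : ℕ} {x : Fin 4 → ℤ} {γ : Polymer}
    (h : γ ∈ shell 𝔟 kmax R x) : R + 2 + 2 * 𝔟.b ^ γ.k ≤ supDist x (anchor 𝔟 γ) :=
  ((mem_shell_iff 𝔟 kmax R x γ).1 h).2.1

/-- Polymers of the shell have sup-distance `≤ 2R + 2` from the centre. -/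
theorem supDist_le_of_mem_shell {𝔟 : BlockSize} {kmax R : ℕ} {x : Fin 4 → ℤ} {γ : Polymer}
    (h : γ ∈ shell 𝔟 kmax R x) : supDist x (anchor 𝔟 γ) ≤ 2 * R + 2 :=
  ((mem_shell_iff 𝔟 kmax R x γ).1 h).2.2

/-- On the shell the influence coefficient is at most `1/16` (`dist ≥ 2b^k`), in particular at most `1`. -/
theorem influenceCoeff_le_of_mem_shell {𝔟 : BlockSize} {kmax R : ℕ} {x : Fin 4 → ℤ} {γ : Polymer}
    (h : γ ∈ shell 𝔟 kmax R x) : influenceCoeff 𝔟 γ x ≤ 1 / 16 := by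
  have hd : R + 2 + 2 * 𝔟.b ^ γ.k ≤ supDist x (anchor 𝔟 γ) := le_supDist_of_mem_shell h
  have hbk : (0 : ℝ) < (𝔟.b : ℝ) ^ γ.k := by
    have := 𝔟.pos
    positivity
  have hd' : 2 * (𝔟.b : ℝ) ^ γ.k ≤ (supDist x (anchor 𝔟 γ) : ℝ) := by
    have : ((R + 2 + 2 * 𝔟.b ^ γ.k : ℕ) : ℝ) ≤ (supDist x (anchor 𝔟 γ) : ℝ) := by exact_mod_cast hd
    push_cast at this
    linarith [show (0 : ℝ) ≤ R from Nat.cast_nonneg R]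
  have hratio : (𝔟.b : ℝ) ^ γ.k / (supDist x (anchor 𝔟 γ) : ℝ) ≤ 1 / 2 := by
    rw [div_le_iff₀ (by linarith)]
    linarith
  have h0 : 0 ≤ (𝔟.b : ℝ) ^ γ.k / (supDist x (anchor 𝔟 γ) : ℝ) := by positivity
  calc influenceCoeff 𝔟 γ x = ((𝔟.b : ℝ) ^ γ.k / (supDist x (anchor 𝔟 γ) : ℝ)) ^ 4 := rfl
    _ ≤ (1 / 2 : ℝ) ^ 4 := pow_le_pow_left₀ h0 hratio 4
    _ = 1 / 16 := by norm_num
/-! ## §4 N20's large-field event of a polymer on `ℤ⁴` configurations -/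

section Event

variable {N : ℕ} [NeZero N]

/-- **N20's LARGE-FIELD EVENT of the polymer `γ` at threshold `ε`, on `ℤ⁴` configurations**: `E_γ = {η | ε ≤ 1 − reTr Ū^k(∂γ)(η)}`
(the `k`-level block-averaged plaquette field of `η` at the `k`-plaquette `γ` is NOT small — the negation of a small-field condition
of [Balaban1989LargeFieldI] (0.3)–(0.5)-kind, in the by-value currency of N20's `measureReal_multiLevel_largeField_le_of_moment`; locator: [Balaban1989LargeFieldI] (0.3)–(0.5) pp. 176–177). -/
def largeFieldEvent (𝔟 : BlockSize) (ε : ℝ) (γ : Polymer) : Set (LGConfig 4 (Matrix.specialUnitaryGroup (Fin N) ℂ)) :=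
  {η | ε ≤ blockField (N := N) 𝔟 γ.k γ.y γ.μ γ.ν γ.hμν η}

/-- The large-field event is measurable (a super-level set of a measurable field). -/
theorem measurableSet_largeFieldEvent (𝔟 : BlockSize) (ε : ℝ) (γ : Polymer) :
    MeasurableSet (largeFieldEvent (N := N) 𝔟 ε γ) :=
  measurableSet_le measurable_const (measurable_blockField (N := N) 𝔟 γ.k γ.y γ.μ γ.ν γ.hμν)

/-- At thresholds `ε > 2` the large-field event is empty (`1 − reTr ≤ 2`). -/
theorem largeFieldEvent_eq_empty_of_two_lt (𝔟 : BlockSize) {ε : ℝ} (hε : 2 < ε) (γ : Polymer) :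
    largeFieldEvent (N := N) 𝔟 ε γ = ∅ := by
  ext η
  simp only [largeFieldEvent, Set.mem_setOf_eq, Set.mem_empty_iff_false, iff_false, not_le]
  exact lt_of_le_of_lt (blockField_mem_Icc (N := N) 𝔟 γ.k γ.y γ.μ γ.ν γ.hμν η).2 hε

/-- At thresholds `ε ≤ 0` the large-field event is everything (`0 ≤ 1 − reTr`). -/
theorem largeFieldEvent_eq_univ_of_nonpos (𝔟 : BlockSize) {ε : ℝ} (hε : ε ≤ 0) (γ : Polymer) :
    largeFieldEvent (N := N) 𝔟 ε γ = Set.univ := by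
  ext η
  simp only [largeFieldEvent, Set.mem_setOf_eq, Set.mem_univ, iff_true]
  exact hε.trans (blockField_mem_Icc (N := N) 𝔟 γ.k γ.y γ.μ γ.ν γ.hμν η).1

end Event

end Summit.QuantumFields.YangMills.Cruxes.UVSeamRec.PolymerData

end
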